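import Summits.Ventures.PercRepro.SixFourTailLemmas
import Summits.Ventures.PercRepro.SixFourResidueFourGenericA

/-!
# PercRepro — C-025 at `(6,4)`: the `g ≥ 101` tail of Theorem G's per-pair certificate at `t = 4`, no plane cap
(mine-2 g22, §21.21 — the twin of `SixFourResidueThreeGenericTail`; lead RULING (ng)(1)(b); re-cut on p3's 3178: imports SixFourTailLemmas + SixFourResidueFourGenericA only)

`PerPair4 g p m` (p3's `SixFourResidueFourGenericA`) is the per-pair inequality (C′_τ) of §21.13.3 with the partner
term: with `c = g − p`, `K₄ = c − 2/5`, `y_P = Fg(g)/C(g,2)`, `y_m = [y_P·C(m,2) + bonus(m) + (2/3)ε(m)·C(g − m, 2)]/(g − m)`,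
`L₄ = y_m(p − m) + K₄·δ(m) − (8/5)C(m,4) − (2/3)ε(m)C(p − m, 2)`, `base₄ = K₄·δ(p) − (8/5)C(p,4)` and the crude partner
charge `xiCrude g p = 2^{1 + min(2p − g, p − 1)}` (`0` if `2p < g`): `C(m,2)·(base₄ + (6/5)·xiCrude) ≤ C(p,2)·L₄`.
The tail `g ≥ 101` follows §21.19 line by line with the `t = 4` constants: Lemma A₄ `Fg(g) ≥ (799/1000)·2^g`, the
sufficient condition (S₄), Regime II (`c ≥ 11`) by the price term alone, Regime I (`3 ≤ c ≤ 10`) by the price term for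
`j ≥ j₀(c)` and by the `δ`-term on the four cells `(3,1), (3,2), (4,1), (5,1)`.
-/

namespace PercRepro.SixFour

/-! ## The partner bound -/

/-- `xiCrude g p · 2^{g − p} ≤ 2·2^p`: the crude partner charge is at most `2·2^{p − c}` (`c = g − p`), and `0` when `2p < g`. -/
theorem xiCrude_le {g p : ℕ} (hpg : p ≤ g) : (xiCrude g p : ℚ) * 2 ^ (g - p) ≤ 2 * 2 ^ p := by
  unfold xiCrude
  split_ifs with h
  · simp
  · have hmin : min (2 * p - g) (p - 1) ≤ 2 * p - g := min_le_left _ _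
    have e : 2 * p - g + (g - p) = p := by omega
    push_cast
    have h2 : (2 : ℚ) ^ min (2 * p - g) (p - 1) ≤ 2 ^ (2 * p - g) :=
      pow_le_pow_right₀ (by norm_num) hmin
    calc (2 : ℚ) ^ (1 + min (2 * p - g) (p - 1)) * 2 ^ (g - p)
        = 2 * 2 ^ min (2 * p - g) (p - 1) * 2 ^ (g - p) := by rw [pow_add, pow_one]
      _ ≤ 2 * 2 ^ (2 * p - g) * 2 ^ (g - p) := by gcongr
      _ = 2 * 2 ^ p := by rw [mul_assoc, ← pow_add, e]

/-! ## Step 0 and the sufficient condition (S₄) -/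

/-- With `c = g − p`, `j = p − m`: `L₄ = (j/(c+j))·[y_P·C(m,2) + bonus(m)] + ε(m)·jc/3 + K₄·δ(m) − (8/5)·C(m,4)`. -/
theorem Lterm4_eq {g p m : ℕ} (hmp : m ≤ p) (hpg : p ≤ g) (hm : m < g) :
    Lterm4 g p m = ((p - m : ℕ) : ℚ) / (((g - p : ℕ) : ℚ) + ((p - m : ℕ) : ℚ)) * (yP4 g * (m.choose 2 : ℚ) + bonus m)
      + (eps m : ℚ) * ((p - m : ℕ) : ℚ) * ((g - p : ℕ) : ℚ) / 3
      + (((g - p : ℕ) : ℚ) - 2 / 5) * (delta m : ℚ) - 8 / 5 * (m.choose 4 : ℚ) := by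
  have e1 : ((g - m : ℕ) : ℚ) = ((g - p : ℕ) : ℚ) + ((p - m : ℕ) : ℚ) := by
    rw [Nat.cast_sub hm.le, Nat.cast_sub hpg, Nat.cast_sub hmp]; ring
  have e2 : ((g : ℚ) - p) = ((g - p : ℕ) : ℚ) := by rw [Nat.cast_sub hpg]
  have c1 : (((g - m).choose 2 : ℕ) : ℚ) = ((g - m : ℕ) : ℚ) * (((g - m : ℕ) : ℚ) - 1) / 2 := Nat.cast_choose_two ℚ (g - m)
  have c2 : (((p - m).choose 2 : ℕ) : ℚ) = ((p - m : ℕ) : ℚ) * (((p - m : ℕ) : ℚ) - 1) / 2 := Nat.cast_choose_two ℚ (p - m)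
  have hD : ((g - p : ℕ) : ℚ) + ((p - m : ℕ) : ℚ) ≠ 0 := by
    have : (0 : ℚ) < ((g - m : ℕ) : ℚ) := by exact_mod_cast (by omega : 0 < g - m)
    rw [← e1]; exact this.ne'
  unfold Lterm4 yPrice4
  rw [c1, c2, sub_right_comm, e2, e1]
  field_simp
  ring

/-- `Q₄ = ε(m)·jc/3 + δ(m)·(K₄ + (2/5)·t) + (8/5)·C(m,4)·(t − 1)`, `t = j/(c+j)`. -/
def tailQ4 (c j : ℚ) (m : ℕ) : ℚ :=
  (eps m : ℚ) * j * c / 3 + (delta m : ℚ) * ((c - 2 / 5) + 2 / 5 * (j / (c + j))) + 8 / 5 * (m.choose 4 : ℚ) * (j / (c + j) - 1)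

/-- `Q₄ ≥ 0` for `c ≥ 3`, `j ≥ 1`. -/
theorem tailQ4_nonneg {c j : ℚ} (hc : 3 ≤ c) (hj : 1 ≤ j) (m : ℕ) : 0 ≤ tailQ4 c j m := by
  unfold tailQ4
  have hE : (0 : ℚ) ≤ (eps m : ℚ) := by positivity
  have hD : (0 : ℚ) ≤ (delta m : ℚ) := by positivity
  have hC4 : (m.choose 4 : ℚ) ≤ (delta m : ℚ) := by exact_mod_cast choose_four_le_delta m
  have hC4n : (0 : ℚ) ≤ (m.choose 4 : ℚ) := by positivity
  have ht0 : 0 ≤ j / (c + j) := by positivity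
  have ht : j / (c + j) ≤ 1 := by rw [div_le_one (by linarith)]; linarith
  have h1 : 0 ≤ (eps m : ℚ) * j * c / 3 := by positivity
  have h2 : (8 / 5 : ℚ) * (m.choose 4 : ℚ) * (j / (c + j) - 1) ≥ -(8 / 5) * (delta m : ℚ) := by nlinarith
  have h3 : (delta m : ℚ) * (2 / 5 * (j / (c + j))) ≥ 0 := by positivity
  nlinarith [h1, h2, h3, hD, hc]

/-- **The sufficient condition (S₄) gives `PerPair4`**: `(K₄ + (12/5)/2^c)·2^p ≤ t·y_P·C(p,2) + Q₄ ⇒ PerPair4 g p m`. -/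
theorem perPair4_of_S {g p m : ℕ} (hmp : m < p) (hpg : p + 3 ≤ g)
    (hS : ((((g - p : ℕ) : ℚ) - 2 / 5) + 12 / 5 / 2 ^ (g - p)) * 2 ^ p ≤
      ((p - m : ℕ) : ℚ) / (((g - p : ℕ) : ℚ) + ((p - m : ℕ) : ℚ)) * (yP4 g * (p.choose 2 : ℚ))
        + tailQ4 ((g - p : ℕ) : ℚ) ((p - m : ℕ) : ℚ) m) : PerPair4 g p m := by
  unfold PerPair4
  rw [Lterm4_eq hmp.le (by omega) (by omega)]
  unfold base4
  rw [show ((g : ℚ) - p) = ((g - p : ℕ) : ℚ) by rw [Nat.cast_sub (by omega)]]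
  unfold tailQ4 at hS
  set c : ℚ := ((g - p : ℕ) : ℚ) with hc_def
  set j : ℚ := ((p - m : ℕ) : ℚ) with hj_def
  set t : ℚ := j / (c + j) with ht_def
  have hc : (3 : ℚ) ≤ c := by rw [hc_def]; exact_mod_cast (by omega : 3 ≤ g - p)
  have hj : (1 : ℚ) ≤ j := by rw [hj_def]; exact_mod_cast (by omega : 1 ≤ p - m)
  have ht0 : 0 ≤ t := by rw [ht_def]; positivity
  have ht1 : t ≤ 1 := by rw [ht_def, div_le_one (by linarith)]; linarith
  have hC2 : (0 : ℚ) ≤ (m.choose 2 : ℚ) := by positivity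
  have hC2P2 : (m.choose 2 : ℚ) ≤ (p.choose 2 : ℚ) := by exact_mod_cast Nat.choose_le_choose 2 hmp.le
  have hP2 : (0 : ℚ) ≤ (p.choose 2 : ℚ) := by positivity
  have hDp : (delta p : ℚ) ≤ 2 ^ p := by exact_mod_cast delta_le_two_pow p
  have hC4p : (0 : ℚ) ≤ (p.choose 4 : ℚ) := by positivity
  have hD : (0 : ℚ) ≤ (delta m : ℚ) := by positivity
  have hE : (0 : ℚ) ≤ (eps m : ℚ) := by positivity
  have hC4 : (0 : ℚ) ≤ (m.choose 4 : ℚ) := by positivity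
  have hK : (0 : ℚ) ≤ c - 2 / 5 := by linarith
  have h2c : (0 : ℚ) < 2 ^ (g - p) := by positivity
  have hXi : (xiCrude g p : ℚ) ≤ 2 * 2 ^ p / 2 ^ (g - p) := by
    rw [le_div_iff₀ h2c]; exact xiCrude_le (by omega)
  have hQ : 0 ≤ (eps m : ℚ) * j * c / 3 + (delta m : ℚ) * ((c - 2 / 5) + 2 / 5 * t) + 8 / 5 * (m.choose 4 : ℚ) * (t - 1) := by
    have := tailQ4_nonneg hc hj m
    unfold tailQ4 at this
    exact this
  -- (1) the left side is at most `C(m,2)·(K₄·2^p + (12/5)·2^p/2^c)`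
  have h1 : (m.choose 2 : ℚ) * (((c - 2 / 5) * (delta p : ℚ) - 8 / 5 * (p.choose 4 : ℚ)) + 6 / 5 * (xiCrude g p : ℚ)) ≤
      (m.choose 2 : ℚ) * (((c - 2 / 5) + 12 / 5 / 2 ^ (g - p)) * 2 ^ p) := by
    apply mul_le_mul_of_nonneg_left _ hC2
    have := mul_le_mul_of_nonneg_left hDp hK
    have e : (12 / 5 / 2 ^ (g - p) : ℚ) * 2 ^ p = 6 / 5 * (2 * 2 ^ p / 2 ^ (g - p)) := by ring
    nlinarith [hXi, e]
  -- (2) `hS` scaled by `C(m,2)`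
  have h2 := mul_le_mul_of_nonneg_left hS hC2
  -- (3) `C(m,2)·Q₄ ≤ C(p,2)·Q₄`
  have h3 := mul_le_mul_of_nonneg_right hC2P2 hQ
  -- (4) the bookkeeping of `bonus = (2/5)δ + (8/5)C(m,4)`: `t·bonus − (2/5)δ·t − (8/5)C(m,4)·t = 0`
  have hb : bonus m = 2 / 5 * (delta m : ℚ) + 8 / 5 * (m.choose 4 : ℚ) := rfl
  have h4 : 0 ≤ (p.choose 2 : ℚ) * (t * bonus m - (delta m : ℚ) * (2 / 5 * t) - 8 / 5 * (m.choose 4 : ℚ) * t) := by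
    apply mul_nonneg hP2
    rw [hb]
    nlinarith [ht0, ht1, hC4]
  linarith [h1, h2, h3, h4]

/-! ## Regime II: `c = g − p ≥ 11` — the price term alone -/

/-- (R2₄) in `ℚ`: `1000·(c+1)·((c − 2/5)·2^c + 12/5)·C(g,2) ≤ 799·2^c·2^c·C(p,2)` for `g ≥ 101`, `3 ≤ p`, `c = g − p ≥ 11`. -/
theorem R2_rat4 {g p : ℕ} (hg : 101 ≤ g) (hp : 3 ≤ p) (hpg : p + 11 ≤ g) :
    1000 * (((g - p : ℕ) : ℚ) + 1) * ((((g - p : ℕ) : ℚ) - 2 / 5) * 2 ^ (g - p) + 12 / 5) * (g.choose 2 : ℚ) ≤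
      799 * 2 ^ (g - p) * 2 ^ (g - p) * (p.choose 2 : ℚ) := by
  rw [Nat.cast_choose_two ℚ g, Nat.cast_choose_two ℚ p]
  set c : ℕ := g - p with hc_def
  have hgq : (101 : ℚ) ≤ g := by exact_mod_cast hg
  have hpq : (3 : ℚ) ≤ p := by exact_mod_cast hp
  have hc11 : 11 ≤ c := by omega
  have hcq11 : (11 : ℚ) ≤ c := by exact_mod_cast hc11
  have h2c : (0 : ℚ) < 2 ^ c := by positivity
  have hgg : (0 : ℚ) ≤ (g : ℚ) * (g - 1) := by nlinarith
  have hpos : (0 : ℚ) ≤ 1000 * ((c : ℚ) + 1) * (((c : ℚ) - 2 / 5) * 2 ^ c + 12 / 5) := by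
    have : (0 : ℚ) ≤ ((c : ℚ) - 2 / 5) * 2 ^ c := mul_nonneg (by linarith) h2c.le
    positivity
  rcases Nat.lt_or_ge g (2 * c) with hlt | hle
  · -- (II-b): `2c > g`: `C(g,2) ≤ c(2c−1)`, `C(p,2) ≥ 3`, and `(c − 2/5)·2^c + 12/5 ≤ (c + 2)·2^c`, `2^c ≥ 4c⁴`
    have hc23 : 23 ≤ c := by omega
    have hB : (4 : ℚ) * (c : ℚ) ^ 4 ≤ 2 ^ c := by exact_mod_cast two_pow_ge_four_pow_four hc23
    have hg2c : (g : ℚ) ≤ 2 * c - 1 := by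
      have : g + 1 ≤ 2 * c := hlt
      have : ((g + 1 : ℕ) : ℚ) ≤ ((2 * c : ℕ) : ℚ) := by exact_mod_cast this
      push_cast at this; linarith
    have hG : (g : ℚ) * (g - 1) ≤ 2 * c * (2 * c - 1) := by nlinarith
    have hP : (6 : ℚ) ≤ (p : ℚ) * (p - 1) := by nlinarith
    have h1 : (((c : ℚ) - 2 / 5) * 2 ^ c + 12 / 5) ≤ ((c : ℚ) + 2) * 2 ^ c := by
      have : (1 : ℚ) ≤ 2 ^ c := one_le_pow₀ (by norm_num)
      nlinarith
    have h_a : ((c : ℚ) + 1) * ((c : ℚ) + 2) ≤ 4 * (c : ℚ) ^ 2 := by nlinarith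
    have h_b : 2 * (c : ℚ) * (2 * c - 1) ≤ 4 * (c : ℚ) ^ 2 := by nlinarith
    have hab := mul_le_mul h_a h_b (by nlinarith) (by positivity)
    have hpoly : 1000 * ((c : ℚ) + 1) * ((c : ℚ) + 2) * (2 * c * (2 * c - 1)) ≤ 16000 * (c : ℚ) ^ 4 := by nlinarith
    have hL : 1000 * ((c : ℚ) + 1) * (((c : ℚ) - 2 / 5) * 2 ^ c + 12 / 5) * ((g : ℚ) * (g - 1) / 2) ≤
        8000 * (c : ℚ) ^ 4 * 2 ^ c := by
      have hA : 1000 * ((c : ℚ) + 1) * (((c : ℚ) - 2 / 5) * 2 ^ c + 12 / 5) ≤ 1000 * ((c : ℚ) + 1) * (((c : ℚ) + 2) * 2 ^ c) :=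
        mul_le_mul_of_nonneg_left h1 (by positivity)
      have hB' := mul_le_mul_of_nonneg_left hG (by positivity : (0 : ℚ) ≤ 1000 * ((c : ℚ) + 1) * (((c : ℚ) + 2) * 2 ^ c))
      nlinarith
    have hR : (8000 : ℚ) * (c : ℚ) ^ 4 * 2 ^ c ≤ 799 * 2 ^ c * 2 ^ c * ((p : ℚ) * (p - 1) / 2) := by
      have h1' : (4 : ℚ) * (c : ℚ) ^ 4 * 2 ^ c ≤ 2 ^ c * 2 ^ c := mul_le_mul_of_nonneg_right hB h2c.le
      have h2' : (799 : ℚ) * 2 ^ c * 2 ^ c * 3 ≤ 799 * 2 ^ c * 2 ^ c * ((p : ℚ) * (p - 1) / 2) :=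
        mul_le_mul_of_nonneg_left (by linarith) (by positivity)
      nlinarith
    linarith
  · -- (II-a): `2c ≤ g`: `9801·C(g,2) ≤ 40804·C(p,2)` with `regII4_a`
    have hA : ((8160800 * ((c + 1) * ((5 * c - 2) * 2 ^ c + 12)) : ℕ) : ℚ) ≤ ((7830999 * 4 ^ c : ℕ) : ℚ) := by
      exact_mod_cast regII4_a hc11
    push_cast [Nat.cast_sub (by omega : 2 ≤ 5 * c)] at hA
    have hρ : (99 : ℚ) * g ≤ 202 * ((p : ℚ) - 1) := by
      have : 99 * g ≤ 202 * (p - 1) := by omega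
      have : ((99 * g : ℕ) : ℚ) ≤ ((202 * (p - 1) : ℕ) : ℚ) := by exact_mod_cast this
      push_cast [Nat.cast_sub (by omega : 1 ≤ p)] at this
      linarith
    have hρ' : (9801 : ℚ) * ((g : ℚ) * (g - 1)) ≤ 40804 * ((p : ℚ) * (p - 1)) := by nlinarith
    have h4c : (4 : ℚ) ^ c = 2 ^ c * 2 ^ c := by rw [← mul_pow]; norm_num
    rw [h4c] at hA
    have h1 := mul_le_mul_of_nonneg_right hA hgg
    have h2 := mul_le_mul_of_nonneg_left hρ' (by positivity : (0 : ℚ) ≤ 799 * 2 ^ c * 2 ^ c)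
    nlinarith

/-- **Regime II at `t = 4`**: `PerPair4 g p m` for `g ≥ 101`, `3 ≤ p`, `p + 11 ≤ g`, `m < p`. -/
theorem perPair4_regII {g p m : ℕ} (hg : 101 ≤ g) (hp : 3 ≤ p) (hpg : p + 11 ≤ g) (hmp : m < p) : PerPair4 g p m := by
  apply perPair4_of_S hmp (by omega)
  set c : ℚ := ((g - p : ℕ) : ℚ) with hc_def
  set j : ℚ := ((p - m : ℕ) : ℚ) with hj_def
  have hc : (11 : ℚ) ≤ c := by rw [hc_def]; exact_mod_cast (by omega : 11 ≤ g - p)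
  have hj : (1 : ℚ) ≤ j := by rw [hj_def]; exact_mod_cast (by omega : 1 ≤ p - m)
  have hQ := tailQ4_nonneg (c := c) (by linarith) hj m
  have hP2 : (0 : ℚ) ≤ (p.choose 2 : ℚ) := by positivity
  have hG2 : (0 : ℚ) < (g.choose 2 : ℚ) := by exact_mod_cast Nat.choose_pos (by omega : 2 ≤ g)
  have hY : (799 / 1000 : ℚ) * 2 ^ g ≤ Fg g := Fg_ge hg
  have hR2 := R2_rat4 hg hp hpg
  have hpow : (2 : ℚ) ^ g = 2 ^ (g - p) * 2 ^ p := by rw [← pow_add]; congr 1; omega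
  have h2p : (0 : ℚ) < 2 ^ p := by positivity
  have h2c : (0 : ℚ) < 2 ^ (g - p) := by positivity
  obtain ⟨u, hu⟩ : ∃ u : ℚ, u = 12 / 5 / 2 ^ (g - p) := ⟨_, rfl⟩
  have hu' : u * 2 ^ (g - p) = 12 / 5 := by rw [hu]; field_simp
  have hu0 : 0 ≤ u := by rw [hu]; positivity
  rw [← hu]
  set K : ℚ := (c - 2 / 5) + u with hK_def
  have hKpos : 0 ≤ K := by rw [hK_def]; linarith
  -- `K·(c+1)·2^p ≤ y_P·C(p,2)`
  have hX : K * (c + 1) * 2 ^ p ≤ yP4 g * (p.choose 2 : ℚ) := by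
    have e : yP4 g * (p.choose 2 : ℚ) = Fg g * (p.choose 2 : ℚ) / (g.choose 2 : ℚ) := by unfold yP4; ring
    rw [e, le_div_iff₀ hG2]
    have h1 := mul_le_mul_of_nonneg_right hY hP2
    rw [hpow] at h1
    have hA : K * (c + 1) * (g.choose 2 : ℚ) * (1000 * 2 ^ (g - p)) ≤ 799 * 2 ^ (g - p) * 2 ^ (g - p) * (p.choose 2 : ℚ) := by
      have e2 : K * (c + 1) * (g.choose 2 : ℚ) * (1000 * 2 ^ (g - p)) =
          1000 * (c + 1) * ((c - 2 / 5) * 2 ^ (g - p) + u * 2 ^ (g - p)) * (g.choose 2 : ℚ) := by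
        rw [hK_def]; ring
      rw [e2, hu', hc_def]
      exact hR2
    have hpos : (0 : ℚ) < 1000 * 2 ^ (g - p) := by positivity
    refine le_of_mul_le_mul_right ?_ hpos
    have h2 := mul_le_mul_of_nonneg_right hA h2p.le
    have h3 := mul_le_mul_of_nonneg_left h1 hpos.le
    nlinarith [h2, h3]
  have ht : 1 / (c + 1) ≤ j / (c + j) := by
    rw [div_le_div_iff₀ (by linarith) (by linarith)]; nlinarith
  have hYP : 0 ≤ yP4 g * (p.choose 2 : ℚ) := by
    have : (0 : ℚ) ≤ K * (c + 1) * 2 ^ p := by positivity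
    linarith
  have h5 : 1 / (c + 1) * (K * (c + 1) * 2 ^ p) = K * 2 ^ p := by field_simp
  calc K * 2 ^ p = 1 / (c + 1) * (K * (c + 1) * 2 ^ p) := h5.symm
    _ ≤ 1 / (c + 1) * (yP4 g * (p.choose 2 : ℚ)) := mul_le_mul_of_nonneg_left hX (by positivity)
    _ ≤ j / (c + j) * (yP4 g * (p.choose 2 : ℚ)) := mul_le_mul_of_nonneg_right ht hYP
    _ ≤ j / (c + j) * (yP4 g * (p.choose 2 : ℚ)) + tailQ4 c j m := by linarith

/-! ## Regime I: `3 ≤ c ≤ 10` — the price term for `j ≥ j₀(c)`, the `δ`-term on four cells -/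

/-- A `δ`-term cell at `t = 4`: with `t = j/(c+j)` and `2^p = 2^m·2^j`, if `A·2^p ≤ y_P·C(p,2)` and the numeric
inequality `K·2^j ≤ t·A·2^j + (927/1000)·[jc/3 + (c − 2/5) − 131/625]` holds (`K = c − 2/5 + (12/5)/2^c`), then (S₄) holds (`m ≥ 12`). -/
theorem S_of_delta_cell4 {c j m : ℕ} (hm12 : 12 ≤ m) {A YP K : ℚ} (hX : A * (2 ^ m * 2 ^ j) ≤ YP)
    (hbr : 0 ≤ ((j : ℚ) * c / 3 + ((c : ℚ) - 2 / 5) - 131 / 625))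
    (hnum : K * 2 ^ j ≤ (j : ℚ) / (c + j) * A * 2 ^ j + 927 / 1000 * ((j : ℚ) * c / 3 + ((c : ℚ) - 2 / 5) - 131 / 625)) :
    K * (2 ^ m * 2 ^ j) ≤ (j : ℚ) / (c + j) * YP + tailQ4 c j m := by
  obtain ⟨hD, hC4, hE⟩ := delta_bounds hm12
  have hDnn : (0 : ℚ) ≤ (delta m : ℚ) := by positivity
  have h2m : (0 : ℚ) ≤ 2 ^ m := by positivity
  have hjc : (0 : ℚ) ≤ (j : ℚ) * c / 3 := by positivity
  have ht : (0 : ℚ) ≤ (j : ℚ) / (c + j) := by positivity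
  have hC4n : (0 : ℚ) ≤ (m.choose 4 : ℚ) := by positivity
  -- `Q₄ ≥ δ·[bracket]`
  have hQ1 : (delta m : ℚ) * ((j : ℚ) * c / 3 + ((c : ℚ) - 2 / 5) - 131 / 625) ≤ tailQ4 c j m := by
    unfold tailQ4
    have h1 : (delta m : ℚ) * ((j : ℚ) * c / 3) ≤ (eps m : ℚ) * j * c / 3 := by
      have := mul_le_mul_of_nonneg_right hE hjc; linarith
    have h2 : (8 / 5 : ℚ) * (m.choose 4 : ℚ) * ((j : ℚ) / (c + j) - 1) ≥ -(131 / 625) * (delta m : ℚ) := by nlinarith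
    have h3 : (0 : ℚ) ≤ (delta m : ℚ) * (2 / 5 * ((j : ℚ) / (c + j))) := by positivity
    nlinarith
  have hQ2 : (927 / 1000 : ℚ) * 2 ^ m * ((j : ℚ) * c / 3 + ((c : ℚ) - 2 / 5) - 131 / 625) ≤
      (delta m : ℚ) * ((j : ℚ) * c / 3 + ((c : ℚ) - 2 / 5) - 131 / 625) :=
    mul_le_mul_of_nonneg_right hD hbr
  have hnum' := mul_le_mul_of_nonneg_right hnum h2m
  have hX' : (j : ℚ) / (c + j) * A * 2 ^ j * 2 ^ m ≤ (j : ℚ) / (c + j) * YP := by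
    have := mul_le_mul_of_nonneg_left hX ht
    nlinarith
  nlinarith

/-- **Regime I at `t = 4`**: `PerPair4 g p m` for `g ≥ 101`, `p + 3 ≤ g ≤ p + 10`, `2 ≤ m < p`. -/
theorem perPair4_regI {g p m : ℕ} (hg : 101 ≤ g) (hpg : p + 3 ≤ g) (hgp : g ≤ p + 10) (hm : 2 ≤ m) (hmp : m < p) :
    PerPair4 g p m := by
  apply perPair4_of_S hmp hpg
  obtain ⟨c, hc⟩ : ∃ c, c = g - p := ⟨_, rfl⟩
  obtain ⟨j, hj⟩ : ∃ j, j = p - m := ⟨_, rfl⟩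
  rw [← hc, ← hj]
  have hc3 : 3 ≤ c := by omega
  have hc10 : c ≤ 10 := by omega
  have hj1 : 1 ≤ j := by omega
  have hp91 : 91 ≤ p := by omega
  have hcq3 : (3 : ℚ) ≤ c := by exact_mod_cast hc3
  have hjq1 : (1 : ℚ) ≤ j := by exact_mod_cast hj1
  have hQ := tailQ4_nonneg (c := c) (j := j) (by linarith) hjq1 m
  have hP2 : (0 : ℚ) ≤ (p.choose 2 : ℚ) := by positivity
  have hG2 : (0 : ℚ) < (g.choose 2 : ℚ) := by exact_mod_cast Nat.choose_pos (by omega : 2 ≤ g)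
  have hY : (799 / 1000 : ℚ) * 2 ^ g ≤ Fg g := Fg_ge hg
  have hρ := rho_regI hg hc hc10 hpg
  have hpow : (2 : ℚ) ^ g = 2 ^ c * 2 ^ p := by rw [← pow_add]; congr 1; omega
  have h2p : (0 : ℚ) < 2 ^ p := by positivity
  have h2c : (0 : ℚ) < 2 ^ c := by positivity
  have hX : (799 / 1000 : ℚ) * (((99 : ℚ) - c) / 100) ^ 2 * 2 ^ c * 2 ^ p ≤ yP4 g * (p.choose 2 : ℚ) := by
    have e : yP4 g * (p.choose 2 : ℚ) = Fg g * (p.choose 2 : ℚ) / (g.choose 2 : ℚ) := by unfold yP4; ring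
    rw [e, le_div_iff₀ hG2]
    have h1 := mul_le_mul_of_nonneg_right hY hP2
    rw [hpow] at h1
    have h2 := mul_le_mul_of_nonneg_left hρ (by positivity : (0 : ℚ) ≤ (799 / 1000) * 2 ^ c * 2 ^ p)
    have h3 : (0 : ℚ) ≤ (((99 : ℚ) - c) / 100) ^ 2 := by positivity
    nlinarith
  have hYP : 0 ≤ yP4 g * (p.choose 2 : ℚ) := by
    have h3 : (0 : ℚ) ≤ (799 / 1000 : ℚ) * (((99 : ℚ) - c) / 100) ^ 2 * 2 ^ c * 2 ^ p := by positivity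
    linarith
  have hpm : (2 : ℚ) ^ p = 2 ^ m * 2 ^ j := by rw [← pow_add]; congr 1; omega
  interval_cases c
  · -- c = 3
    rcases Nat.lt_or_ge j 3 with hj3 | hj3
    · rw [hpm] at hX ⊢
      interval_cases j <;> exact S_of_delta_cell4 (by omega) hX (by norm_num) (by norm_num)
    · have hjq : (3 : ℚ) ≤ j := by exact_mod_cast hj3
      exact S_of_yterm (3 : ℚ) (by norm_num) (by norm_num) hjq hX (by norm_num) hQ h2p.le hYP
  · -- c = 4
    rcases Nat.lt_or_ge j 2 with hj2 | hj2
    · rw [hpm] at hX ⊢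
      interval_cases j
      exact S_of_delta_cell4 (by omega) hX (by norm_num) (by norm_num)
    · have hjq : (2 : ℚ) ≤ j := by exact_mod_cast hj2
      exact S_of_yterm (2 : ℚ) (by norm_num) (by norm_num) hjq hX (by norm_num) hQ h2p.le hYP
  · -- c = 5
    rcases Nat.lt_or_ge j 2 with hj2 | hj2
    · rw [hpm] at hX ⊢
      interval_cases j
      exact S_of_delta_cell4 (by omega) hX (by norm_num) (by norm_num)
    · have hjq : (2 : ℚ) ≤ j := by exact_mod_cast hj2
      exact S_of_yterm (2 : ℚ) (by norm_num) (by norm_num) hjq hX (by norm_num) hQ h2p.le hYP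
  all_goals exact S_of_yterm (1 : ℚ) (by norm_num) (by norm_num) hjq1 hX (by norm_num) hQ h2p.le hYP

/-- **The `t = 4` tail** (§21.21): `PerPair4 g p m` for every `g ≥ 101`, `3 ≤ p ≤ g − 3`, `2 ≤ m < p`. -/
theorem perPair4_tail {g p m : ℕ} (hg : 101 ≤ g) (hp : 3 ≤ p) (hpg : p + 3 ≤ g) (hm : 2 ≤ m) (hmp : m < p) :
    PerPair4 g p m := by
  rcases Nat.lt_or_ge g (p + 11) with h | h
  · exact perPair4_regI hg hpg (by omega) hm hmp
  · exact perPair4_regII hg hp h hmp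

/-- **The `t = 4` per-pair tail in the interface form** (p3's `PerPairTail4`, ruling (ng)(1)(b)): `PerPair4 g p m` for
every `g ≥ 101`, `3 ≤ p ≤ g − 3`, `2 ≤ m < p` — with the `10 ≤ g ≤ 100` table this is Theorem G (§21.13) for every
generic solid, no plane cap. -/
theorem perPair4_tail_forall : ∀ g, 101 ≤ g → ∀ p m, 3 ≤ p → p + 3 ≤ g → 2 ≤ m → m < p → PerPair4 g p m :=
  fun _ hg _ _ hp hpg hm hmp => perPair4_tail hg hp hpg hm hmp

end PercRepro.SixFour
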